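import Summits.AtomisticToContinuum.Crystallization.Theorems.HullExactificationCascadeExactHcpLocalTheoremExactify
import Summits.AtomisticToContinuum.Crystallization.Theses.HullExactificationCascade

/-!
# Route HullExactificationCascade — item `ExactHcpLocalTheorem` (G): the `η = 0` hcp local theorem, proved

Closing file for `stmt-AtomisticToContinuum-12093` (support (G) of route HullExactificationCascade):
for `9/10 < a < 1`, `|h − a√(2/3)| ≤ a/100` and a nonempty `S ⊆ ℝ³` all of whose punctured
`13/10 a`-neighbourhoods are, for every `η > 0`, `η`-congruent by a linear isometry and a bijection
to the twelve-point shell of `hcpStacking a h` at `0`, `S = g '' hcpStacking a h` for a Euclidean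
isometry `g` — on AND off the ideal ratio `h = a√(2/3)`.

## Proof (helper files `…ExactHcpLocalTheoremShell/Frame/Rigidity/Hexagon/Bond/Propagation/Layers/Exactify`)

1. EXACTIFY (`exact_cluster`): finitely many bijections ⇒ one bijection for all `η`; Gram matrices
   agree; a Gram-preserving map on the punctured cluster extends to a linear isometry `B_y`; so
   `S ∩ B(y, 13/10 a) = y + B_y '' N` with `N = hcp ∩ B(0, 13/10 a)` the thirteen-point cluster
   (indexed by `norm_site_lt_iff`).
2. ALL LAYERS (`all_layers`, this file): normalise a point to `0` with cluster `N`; fill layer `0` by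
   bond rigidity (`image_cluster_eq_of_bond`: the cluster at `z + u` is pinned by exactness on
   `B(z) ∩ B(z + u)` — a five-point sub-configuration argument with the numerics `4h² ≠ 3a²`,
   `h² ≠ 5a²/3`), then stack layers by hexagon rigidity (`image_cluster_of_hexagon`: a cluster containing
   a full hexagon is `N` or its twin `halfTurn '' N`, decided by one more point), up and down, the
   odd layers carrying twin clusters; conjugations by the mirrors `M_u, M_{u−v}, σ_h` (Householder
   reflections) and the tree's `halfTurn` supply all directions.
3. NO ROOM (`eq_hcpStacking_of_clusters`): every point of `ℝ³` is within `√(3a²/4 + h²) < 13/10 a` of a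
   site (`exists_hcp_site_near`), so `S` is the stacking; undo the normalisation
   (`eq_image_hcpStacking`), read the box through `box_envelope`.

References: T. C. Hales, *Dense Sphere Packings*, §1.3 (layer-by-layer argument, ideal ratio;
tree `HalesDSP_layerPackings_holds`); J. H. Conway, N. J. A. Sloane, *SPLAG* Ch. 1 §1.3; the local
criterion for regular systems (Delone–Dolbilin–Shtogrin–Galiulin 1976; Dolbilin–Lagarias–Senechal
1998) is the general print analogue — here the cluster radius is the first shell only, which
suffices because the anticuboctahedral cluster has no antipodal caps and a unique hexagon.
-/

noncomputable section

namespace Summit.AtomisticToContinuum.Crystallization.Theorems.ExactHcpLocal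

open Literature.MathematicalPhysics.StatisticalMechanics

variable {a h : ℝ}

/-! ## Global file: all layers, and the point set is the stacking -/

section Global

open RealInnerProductSpace Literature.Geometry.DiscreteGeometry

/-- **All layers.** If every point of `S` has an hcp cluster and the cluster of `S` at the
origin is exactly `N`, then for every `m` the clusters of `S` at the sites of layer `2m` are `N`
and at the sites of layer `2m + 1` are the twin `halfTurn '' N` — exactly as in the stacking.
Induction on `m` (up: `up_odd`, `up_even`; down: `down_even`, `down_odd`), filling each layer
from its base point `𝔰 k 0 0` (`plane_fill_even`, `plane_fill_odd`). [folklore] -/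
theorem all_layers (ha : 0 < a) (hh : 0 < h) (hh1 : 64 / 100 * a ^ 2 < h ^ 2)
    (hh2 : h ^ 2 < 69 / 100 * a ^ 2) {S : Set (EuclideanSpace ℝ (Fin 3))}
    (hS : ∀ y ∈ S, ∃ A : EuclideanSpace ℝ (Fin 3) ≃ₗᵢ[ℝ] EuclideanSpace ℝ (Fin 3),
      S ∩ Metric.ball y (13 / 10 * a) = (fun n => y + A n) ''
        {p : EuclideanSpace ℝ (Fin 3) | p ∈ hcpStacking a h ∧ ‖p‖ < 13 / 10 * a})
    (h0 : S ∩ Metric.ball 0 (13 / 10 * a) = (fun n => (0 : EuclideanSpace ℝ (Fin 3)) + n) ''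
        {p : EuclideanSpace ℝ (Fin 3) | p ∈ hcpStacking a h ∧ ‖p‖ < 13 / 10 * a}) (m : ℤ) :
    (∀ i j : ℤ, S ∩ Metric.ball (barlowPos a h alternatingHagg (2 * m) i j) (13 / 10 * a) =
      (fun n => barlowPos a h alternatingHagg (2 * m) i j + n) ''
        {p : EuclideanSpace ℝ (Fin 3) | p ∈ hcpStacking a h ∧ ‖p‖ < 13 / 10 * a}) ∧
    (∀ i j : ℤ, S ∩ Metric.ball (barlowPos a h alternatingHagg (2 * m + 1) i j) (13 / 10 * a) =
      (fun n => barlowPos a h alternatingHagg (2 * m + 1) i j + n) ''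
        (halfTurn '' {p : EuclideanSpace ℝ (Fin 3) | p ∈ hcpStacking a h ∧ ‖p‖ < 13 / 10 * a})) := by
  set N := {p : EuclideanSpace ℝ (Fin 3) | p ∈ hcpStacking a h ∧ ‖p‖ < 13 / 10 * a} with hN
  -- a layer from its base point
  have evenLayer : ∀ k : ℤ, Even k →
      S ∩ Metric.ball (barlowPos a h alternatingHagg k 0 0) (13 / 10 * a) =
        (fun n => barlowPos a h alternatingHagg k 0 0 + n) '' N →
      ∀ i j : ℤ, S ∩ Metric.ball (barlowPos a h alternatingHagg k i j) (13 / 10 * a) =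
        (fun n => barlowPos a h alternatingHagg k i j + n) '' N := by
    intro k hk hc i j
    have e : barlowPos a h alternatingHagg k 0 0 + barlowPos a h alternatingHagg 0 i j =
        barlowPos a h alternatingHagg k i j := by
      rw [hcp_add_of_even a h hk]; simp
    have := plane_fill_even ha hh hh1 hh2 hS hc i j
    rwa [e] at this
  have oddLayer : ∀ k : ℤ,
      S ∩ Metric.ball (barlowPos a h alternatingHagg k 0 0) (13 / 10 * a) =
        (fun n => barlowPos a h alternatingHagg k 0 0 + n) '' (halfTurn '' N) →
      ∀ i j : ℤ, S ∩ Metric.ball (barlowPos a h alternatingHagg k i j) (13 / 10 * a) =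
        (fun n => barlowPos a h alternatingHagg k i j + n) '' (halfTurn '' N) := by
    intro k hc i j
    have e : barlowPos a h alternatingHagg k 0 0 + barlowPos a h alternatingHagg 0 i j =
        barlowPos a h alternatingHagg k i j := by
      rw [add_comm, hcp_add_of_even a h Even.zero]; simp
    have := plane_fill_odd ha hh hh1 hh2 hS hc i j
    rwa [e] at this
  -- the layer through a point from the layer through its base, as hypotheses of the moves
  have shiftE : ∀ k : ℤ, (∀ i j : ℤ, S ∩ Metric.ball (barlowPos a h alternatingHagg k i j) (13 / 10 * a) =
        (fun n => barlowPos a h alternatingHagg k i j + n) '' N) → Even k →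
      ∀ i j : ℤ, S ∩ Metric.ball (barlowPos a h alternatingHagg k 0 0 + barlowPos a h alternatingHagg 0 i j)
          (13 / 10 * a) =
        (fun n => barlowPos a h alternatingHagg k 0 0 + barlowPos a h alternatingHagg 0 i j + n) '' N := by
    intro k hk hke i j
    rw [hcp_add_of_even a h hke]; simpa using hk i j
  have shiftO : ∀ k : ℤ, (∀ i j : ℤ, S ∩ Metric.ball (barlowPos a h alternatingHagg k i j) (13 / 10 * a) =
        (fun n => barlowPos a h alternatingHagg k i j + n) '' (halfTurn '' N)) →
      ∀ i j : ℤ, S ∩ Metric.ball (barlowPos a h alternatingHagg k 0 0 + barlowPos a h alternatingHagg 0 i j)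
          (13 / 10 * a) =
        (fun n => barlowPos a h alternatingHagg k 0 0 + barlowPos a h alternatingHagg 0 i j + n) ''
          (halfTurn '' N) := by
    intro k hk i j
    rw [add_comm (barlowPos a h alternatingHagg k 0 0), hcp_add_of_even a h Even.zero]
    simpa using hk i j
  -- from an even layer `2m` to the odd layer `2m + 1` above it
  have upE : ∀ m : ℤ, (∀ i j : ℤ, S ∩ Metric.ball (barlowPos a h alternatingHagg (2 * m) i j) (13 / 10 * a) =
        (fun n => barlowPos a h alternatingHagg (2 * m) i j + n) '' N) →
      ∀ i j : ℤ, S ∩ Metric.ball (barlowPos a h alternatingHagg (2 * m + 1) i j) (13 / 10 * a) =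
        (fun n => barlowPos a h alternatingHagg (2 * m + 1) i j + n) '' (halfTurn '' N) := by
    intro m hm
    have h1 := up_even ha hh hh1 hh2 hS (shiftE (2 * m) hm (even_two_mul m))
    rw [hcp_add_of_even a h (even_two_mul m)] at h1
    simp only [add_zero] at h1
    exact oddLayer (2 * m + 1) h1
  induction m using Int.induction_on with
  | zero =>
    have hc0 : S ∩ Metric.ball (barlowPos a h alternatingHagg (2 * 0) 0 0) (13 / 10 * a) =
        (fun n => barlowPos a h alternatingHagg (2 * 0) 0 0 + n) '' N := by
      rw [mul_zero, barlowPos_alternating_zero]; exact h0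
    have hE := evenLayer (2 * 0) (by simp) hc0
    exact ⟨hE, upE 0 hE⟩
  | succ m ih =>
    obtain ⟨-, hO⟩ := ih
    -- up from the odd layer `2m + 1` to `2m + 2`
    have h1 := up_odd ha hh hh1 hh2 hS (shiftO (2 * m + 1) hO)
    have e : barlowPos a h alternatingHagg (2 * (m : ℤ) + 1) 0 0 +
        (barlowPos a h alternatingHagg 2 0 0 - barlowPos a h alternatingHagg 1 0 0) =
        barlowPos a h alternatingHagg (2 * ((m : ℤ) + 1)) 0 0 := by
      rw [add_sub_left_comm, site_sub_of_odd (by simp), hcp_add_of_even a h (by simp)]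
      congr 1; ring
    rw [e] at h1
    have hE := evenLayer (2 * ((m : ℤ) + 1)) (even_two_mul _) h1
    exact ⟨hE, upE _ hE⟩
  | pred m ih =>
    obtain ⟨hE, -⟩ := ih
    -- down from the even layer `-2m` to `-2m - 1`, then to `-2m - 2`
    have h1 := down_even ha hh hh1 hh2 hS (shiftE (2 * -(m : ℤ)) hE (even_two_mul _))
    have e1 : barlowPos a h alternatingHagg (2 * -(m : ℤ)) 0 0 + barlowPos a h alternatingHagg (-1) 0 0 =
        barlowPos a h alternatingHagg (2 * (-(m : ℤ) - 1) + 1) 0 0 := by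
      rw [hcp_add_of_even a h (even_two_mul _)]; congr 1; ring
    rw [e1] at h1
    have hO := oddLayer _ h1
    have h2 := down_odd ha hh hh1 hh2 hS (shiftO _ hO)
    have e2 : barlowPos a h alternatingHagg (2 * (-(m : ℤ) - 1) + 1) 0 0 + -barlowPos a h alternatingHagg 1 0 0 =
        barlowPos a h alternatingHagg (2 * (-(m : ℤ) - 1)) 0 0 := by
      rw [← sub_eq_add_neg, site_sub_of_odd (by simp)]; congr 1; ring
    rw [e2] at h2
    exact ⟨evenLayer _ (even_two_mul _) h2, hO⟩

/-- **The point set is the stacking.** If every point of `S` has, as its punctured `13/10 a`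
neighbourhood, an hcp cluster (up to a linear isometry), and the neighbourhood of the origin is
exactly the cluster `N` of the stacking, then `S = hcpStacking a h`: by `all_layers` the
clusters of `S` at all sites agree with those of the stacking, so `hcp ⊆ S`; and every point of
`S` is within `√(3a²/4 + h²) < 13/10 a` of a site (`exists_hcp_site_near`), hence lies in that
site's cluster, hence in the stacking. [folklore] -/
theorem eq_hcpStacking_of_clusters (ha : 0 < a) (hh : 0 < h) (hh1 : 64 / 100 * a ^ 2 < h ^ 2)
    (hh2 : h ^ 2 < 69 / 100 * a ^ 2) {S : Set (EuclideanSpace ℝ (Fin 3))}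
    (hS : ∀ y ∈ S, ∃ A : EuclideanSpace ℝ (Fin 3) ≃ₗᵢ[ℝ] EuclideanSpace ℝ (Fin 3),
      S ∩ Metric.ball y (13 / 10 * a) = (fun n => y + A n) ''
        {p : EuclideanSpace ℝ (Fin 3) | p ∈ hcpStacking a h ∧ ‖p‖ < 13 / 10 * a})
    (h0 : S ∩ Metric.ball 0 (13 / 10 * a) = (fun n => (0 : EuclideanSpace ℝ (Fin 3)) + n) ''
        {p : EuclideanSpace ℝ (Fin 3) | p ∈ hcpStacking a h ∧ ‖p‖ < 13 / 10 * a}) :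
    S = hcpStacking a h := by
  set N := {p : EuclideanSpace ℝ (Fin 3) | p ∈ hcpStacking a h ∧ ‖p‖ < 13 / 10 * a} with hN
  have h0N : (0 : EuclideanSpace ℝ (Fin 3)) ∈ N :=
    ⟨⟨0, 0, 0, (barlowPos_alternating_zero a h).symm⟩, by simp; positivity⟩
  have layers := all_layers ha hh hh1 hh2 hS h0
  apply Set.Subset.antisymm
  · intro x hx
    obtain ⟨s, ⟨k, i, j, rfl⟩, hd⟩ := exists_hcp_site_near ha.ne' hh.ne' x
    have hball : x ∈ Metric.ball (barlowPos a h alternatingHagg k i j) (13 / 10 * a) := by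
      rw [Metric.mem_ball]
      have : dist x (barlowPos a h alternatingHagg k i j) ^ 2 < (13 / 10 * a) ^ 2 := by nlinarith
      exact lt_of_pow_lt_pow_left₀ 2 (by positivity) this
    rcases Int.even_or_odd' k with ⟨m, rfl | rfl⟩
    · have hcl := (layers m).1 i j
      have : x ∈ S ∩ Metric.ball (barlowPos a h alternatingHagg (2 * m) i j) (13 / 10 * a) := ⟨hx, hball⟩
      rw [hcl, mem_translate_iff] at this
      exact (mem_hcp_iff_sub_even (even_two_mul m) i j x).2 this.1
    · have hcl := (layers m).2 i j
      have : x ∈ S ∩ Metric.ball (barlowPos a h alternatingHagg (2 * m + 1) i j) (13 / 10 * a) :=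
        ⟨hx, hball⟩
      rw [hcl, mem_translate_iff, mem_image_equiv_iff, halfTurn_symm_apply, ← halfTurn_apply] at this
      obtain ⟨⟨k', i', j', hk'⟩, -⟩ := this
      have e : x = barlowPos a h alternatingHagg (2 * m + 1) i j +
          halfTurn (halfTurn (x - barlowPos a h alternatingHagg (2 * m + 1) i j)) := by
        rw [halfTurn_apply, halfTurn_apply, halfTurnFun_involutive]; abel
      rw [e, hk', hcp_add_halfTurn_of_odd a h (by simp)]
      exact barlowPos_mem _ _ _
  · rintro _ ⟨k, i, j, rfl⟩
    rcases Int.even_or_odd' k with ⟨m, rfl | rfl⟩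
    · have hcl := (layers m).1 i j
      have : barlowPos a h alternatingHagg (2 * m) i j ∈
          S ∩ Metric.ball (barlowPos a h alternatingHagg (2 * m) i j) (13 / 10 * a) := by
        rw [hcl]; exact ⟨0, h0N, by simp⟩
      exact this.1
    · have hcl := (layers m).2 i j
      have : barlowPos a h alternatingHagg (2 * m + 1) i j ∈
          S ∩ Metric.ball (barlowPos a h alternatingHagg (2 * m + 1) i j) (13 / 10 * a) := by
        rw [hcl]; exact ⟨0, ⟨0, h0N, map_zero _⟩, by simp⟩
      exact this.1

end Global


/-! ## Final file: normalisation and the route statement -/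

section Final

open RealInnerProductSpace Literature.Geometry.DiscreteGeometry

/-- **Transport of a cluster identity by a translation.** [folklore] -/
theorem cluster_translate (c : EuclideanSpace ℝ (Fin 3)) {S M : Set (EuclideanSpace ℝ (Fin 3))}
    {z : EuclideanSpace ℝ (Fin 3)} {r : ℝ} (hcl : S ∩ Metric.ball z r = (fun m => z + m) '' M) :
    ((fun x => c + x) '' S) ∩ Metric.ball (c + z) r = (fun m => c + z + m) '' M := by
  ext x
  constructor
  · rintro ⟨⟨x', hx', rfl⟩, hb⟩
    have hx'' : x' ∈ S ∩ Metric.ball z r := by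
      refine ⟨hx', ?_⟩
      rw [Metric.mem_ball] at hb ⊢
      rwa [dist_add_left] at hb
    rw [hcl] at hx''
    obtain ⟨m, hm, he⟩ := hx''
    exact ⟨m, hm, by rw [← he]; abel⟩
  · rintro ⟨m, hm, rfl⟩
    have hzm : z + m ∈ S ∩ Metric.ball z r := by rw [hcl]; exact ⟨m, hm, rfl⟩
    refine ⟨⟨z + m, hzm.1, by abel⟩, ?_⟩
    show dist (c + z + m) (c + z) < r
    rw [add_assoc, dist_add_left]
    exact hzm.2

/-- **Transport of the local rule by a translation.** [folklore] -/
theorem localRule_translate (c : EuclideanSpace ℝ (Fin 3)) {S N : Set (EuclideanSpace ℝ (Fin 3))} {r : ℝ}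
    (hS : ∀ y ∈ S, ∃ A : EuclideanSpace ℝ (Fin 3) ≃ₗᵢ[ℝ] EuclideanSpace ℝ (Fin 3),
      S ∩ Metric.ball y r = (fun n => y + A n) '' N) :
    ∀ y ∈ (fun x => c + x) '' S, ∃ A : EuclideanSpace ℝ (Fin 3) ≃ₗᵢ[ℝ] EuclideanSpace ℝ (Fin 3),
      ((fun x => c + x) '' S) ∩ Metric.ball y r = (fun n => y + A n) '' N := by
  rintro _ ⟨y, hy, rfl⟩
  obtain ⟨A, hA⟩ := hS y hy
  refine ⟨A, ?_⟩
  have hA' : S ∩ Metric.ball y r = (fun m => y + m) '' (A '' N) := by rw [hA, Set.image_image]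
  rw [cluster_translate c hA', Set.image_image]

/-- **The `η = 0` hcp local theorem** (item `ExactHcpLocalTheorem` of route
HullExactificationCascade), as a statement about `a, h` in the envelope
`0 < a`, `0 < h`, `64/100 a² < h² < 69/100 a²`: a nonempty `S ⊆ ℝ³` all of whose punctured
`13/10 a`-neighbourhoods are `η`-congruent (linear isometry + bijection) to the punctured hcp
cluster for every `η > 0` is `g '' hcpStacking a h` for a Euclidean isometry `g`.
Proof: exactify every neighbourhood (`exact_cluster`); normalise one point `y₀` to the origin
with cluster exactly `N` (translate by `−y₀`, apply `B₀⁻¹`); the normalised set is the stacking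
(`eq_hcpStacking_of_clusters`); undo the normalisation. [folklore] -/
theorem eq_image_hcpStacking (ha : 0 < a) (hh : 0 < h) (hh1 : 64 / 100 * a ^ 2 < h ^ 2)
    (hh2 : h ^ 2 < 69 / 100 * a ^ 2) {S : Set (EuclideanSpace ℝ (Fin 3))} (hne : S.Nonempty)
    (hloc : ∀ y ∈ S, ∀ η : ℝ, 0 < η → ∃ A : EuclideanSpace ℝ (Fin 3) →ₗᵢ[ℝ] EuclideanSpace ℝ (Fin 3),
      ∃ e : ↥{z : EuclideanSpace ℝ (Fin 3) | z ∈ S ∧ z ≠ y ∧ dist z y < 13 / 10 * a} ≃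
        ↥{p : EuclideanSpace ℝ (Fin 3) | p ∈ hcpStacking a h ∧ p ≠ 0 ∧ ‖p‖ < 13 / 10 * a},
      ∀ t : ↥{z : EuclideanSpace ℝ (Fin 3) | z ∈ S ∧ z ≠ y ∧ dist z y < 13 / 10 * a},
        dist ((t : EuclideanSpace ℝ (Fin 3)) - y)
          (A ((e t : ↥{p : EuclideanSpace ℝ (Fin 3) | p ∈ hcpStacking a h ∧ p ≠ 0 ∧ ‖p‖ < 13 / 10 * a}) :
            EuclideanSpace ℝ (Fin 3))) ≤ η) :
    ∃ g : EuclideanSpace ℝ (Fin 3) ≃ᵢ EuclideanSpace ℝ (Fin 3), S = g '' hcpStacking a h := by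
  set N := {p : EuclideanSpace ℝ (Fin 3) | p ∈ hcpStacking a h ∧ ‖p‖ < 13 / 10 * a} with hN
  have hS : ∀ y ∈ S, ∃ B : EuclideanSpace ℝ (Fin 3) ≃ₗᵢ[ℝ] EuclideanSpace ℝ (Fin 3),
      S ∩ Metric.ball y (13 / 10 * a) = (fun n => y + B n) '' N :=
    fun y hy => exact_cluster ha hh hh1 hh2 hy (hloc y hy)
  obtain ⟨y₀, hy₀⟩ := hne
  obtain ⟨B₀, hB₀⟩ := hS y₀ hy₀
  -- normalise: translate `y₀` to the origin, then straighten the cluster by `B₀⁻¹`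
  set S₁ := (fun x => -y₀ + x) '' S with hS₁
  set S' := B₀.symm '' S₁ with hS'
  have hrule₁ := localRule_translate (-y₀) hS
  have hrule' : ∀ y ∈ S', ∃ A : EuclideanSpace ℝ (Fin 3) ≃ₗᵢ[ℝ] EuclideanSpace ℝ (Fin 3),
      S' ∩ Metric.ball y (13 / 10 * a) = (fun n => y + A n) '' N := localRule_transport B₀.symm hrule₁
  have h1 : S₁ ∩ Metric.ball 0 (13 / 10 * a) = (fun m => (0 : EuclideanSpace ℝ (Fin 3)) + m) '' (B₀ '' N) := by
    have hB₀' : S ∩ Metric.ball y₀ (13 / 10 * a) = (fun m => y₀ + m) '' (B₀ '' N) := by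
      rw [hB₀, Set.image_image]
    have := cluster_translate (-y₀) hB₀'
    rwa [neg_add_cancel] at this
  have h0' : S' ∩ Metric.ball 0 (13 / 10 * a) = (fun m => (0 : EuclideanSpace ℝ (Fin 3)) + m) '' N := by
    have := cluster_transport B₀.symm h1
    have hgg : B₀.symm '' (B₀ '' N) = N := by rw [← Set.image_comp]; simp
    rwa [map_zero, hgg] at this
  have heq : S' = hcpStacking a h := eq_hcpStacking_of_clusters ha hh hh1 hh2 hrule' h0'
  refine ⟨B₀.toIsometryEquiv.trans (IsometryEquiv.addLeft y₀), ?_⟩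
  have hSS' : S = (fun x => y₀ + B₀ x) '' S' := by
    rw [hS', hS₁, Set.image_image, Set.image_image]
    have : (fun x => y₀ + B₀ (B₀.symm (-y₀ + x))) = id := by
      funext x; simp
    rw [this, Set.image_id]
  rw [hSS', heq]
  have hfun : (fun x => y₀ + B₀ x) = ⇑(B₀.toIsometryEquiv.trans (IsometryEquiv.addLeft y₀)) := by
    funext x
    simp [IsometryEquiv.trans_apply, IsometryEquiv.addLeft_apply, LinearIsometryEquiv.coe_toIsometryEquiv]
  rw [hfun]

end Final

end Summit.AtomisticToContinuum.Crystallization.Theorems.ExactHcpLocal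

namespace Summit.AtomisticToContinuum.Crystallization.Theorems

/-- **Item `ExactHcpLocalTheorem` (stmt-AtomisticToContinuum-12093, support (G) of route
HullExactificationCascade), by name: the `η = 0` hcp local theorem, valid off the ideal ratio.**
For `9/10 < a < 1`, `|h − a√(2/3)| ≤ a/100` and a nonempty `S ⊆ ℝ³` whose every punctured
`13/10 a`-neighbourhood is, for every `η > 0`, `η`-congruent (linear isometry + bijection) to the
twelve-point shell of `hcpStacking a h` at `0`, there is a Euclidean isometry `g` with
`S = g '' hcpStacking a h`.  One line from `ExactHcpLocal.eq_image_hcpStacking` and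
`ExactHcpLocal.box_envelope`. [folklore] -/
theorem exactHcpLocalTheorem_proof :
    Summit.AtomisticToContinuum.Crystallization.Theses.HullExactificationCascade.ExactHcpLocalTheorem := by
  unfold Summit.AtomisticToContinuum.Crystallization.Theses.HullExactificationCascade.ExactHcpLocalTheorem
  intro a h hbox S hne hloc
  obtain ⟨ha, hh, hh1, hh2⟩ := ExactHcpLocal.box_envelope hbox
  exact ExactHcpLocal.eq_image_hcpStacking ha hh hh1 hh2 hne hloc

end Summit.AtomisticToContinuum.Crystallization.Theorems

end
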